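import Literature.Algebra.Homology.ContCohomologyTransgression
import HarnessLib

/-!
# Equivariance of the transgression under endomorphisms of a central extension (theorems only)

Corollary file of `ContCohomologyCentralExtension.lean` / `ContCohomologyTransgression.lean`
(generic, Mathlib continuous cohomology).  For a topological central extension
`1 → A → Ẽ →q→ B → 1` with a continuous section `s`, and a pair of continuous endomorphisms
`ε : Ẽ → Ẽ`, `ψ : B → B` with `q ∘ ε = ψ ∘ q` (e.g. conjugation by an element of a bigger group in
which `Ẽ ↠ B` sits normally — the case of `Π_{U_x}` acting on `1 → I_x → Δ^{c-cn}_{U_x} → Δ_X → 1`,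
[AbsTopIII] Prop. 1.4 (ii)), the transgression `Hom(A, Λ) → H²(B, Λ)` is EQUIVARIANT:

  `H²(ψ) (transgression_s χ) = transgression_s (χ ∘ ε|_A)`   (`transgression_equivariant`).

It is the composite of the three naturality statements of the transgression file: pull-back along
`ψ` (`transgression_pullback`), push-forward along `(ε, ψ)` (`transgression_pushforward`) and
independence of the lift (`transgression_liftChange`: `s ∘ ψ` and `ε ∘ s` are both lifts of `ψ`).
Source: functoriality of `H²` and of factor sets [cite: SerreGaloisCohomology1997, I §2.4].
-/

noncomputable section

open CategoryTheory TopRep ContRepresentation Topology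

namespace ContinuousCohomology

universe v

variable {E B : Type v} [Group E] [TopologicalSpace E] [IsTopologicalGroup E]
  [Group B] [TopologicalSpace B] [IsTopologicalGroup B] (q : E →ₜ* B)
  {Λ : Type v} [AddCommGroup Λ] [TopologicalSpace Λ] [IsTopologicalAddGroup Λ]

omit [IsTopologicalGroup E] [IsTopologicalGroup B] in
/-- A section `s` of `q` composed with `ψ` is a lift of `ψ`. [cite: SerreGaloisCohomology1997, I §2.4] -/
theorem section_comp_isLift (s : C(B, E)) (hs : ∀ b, q (s b) = ContinuousMonoidHom.id B b)
    (ψ : B →ₜ* B) (b : B) :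
    q ((s.comp ψ.toContinuousMap) b) = (ψ.comp (ContinuousMonoidHom.id B)) b := by
  change q (s (ψ b)) = ψ b
  exact hs (ψ b)

/-- **Equivariance of the transgression** under an endomorphism `(ε, ψ)` of the central extension:
`H²(ψ)(transgression_s χ) = transgression_s (χ ∘ ε|_A)`. [cite: SerreGaloisCohomology1997, I §2.4] -/
theorem transgression_equivariant (hA : ∀ a ∈ extKer q, ∀ e : E, e * a = a * e)
    (s : C(B, E)) (hs : ∀ b, q (s b) = ContinuousMonoidHom.id B b)
    (ε : E →ₜ* E) (ψ : B →ₜ* B) (hεψ : ∀ e, q (ε e) = ψ (q e))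
    (χ : Additive (extKer q) →ₜ+ Λ) :
    (ContinuousCohomology.map ψ (trivResHom Λ ψ) 2).hom
        (transgression q (ContinuousMonoidHom.id B) s hs hA χ) =
      transgression q (ContinuousMonoidHom.id B) s hs hA (χ.comp (extKerMap q q ε ψ hεψ)) := by
  -- pull back along `ψ`: the lift `s ∘ ψ` of `ψ`
  have h1 := transgression_pullback q (ContinuousMonoidHom.id B) s hs hA ψ χ
  -- push forward along `(ε, ψ)`: the lift `ε ∘ s` of `ψ`
  have h2 := transgression_pushforward q (ContinuousMonoidHom.id B) s hs q ε ψ hεψ hA hA χ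
  -- the two lifts of `ψ` give the same transgression
  have h3 := transgression_liftChange q (ψ.comp (ContinuousMonoidHom.id B))
    (ε.toContinuousMap.comp s) (lift_push q (ContinuousMonoidHom.id B) s hs q ε ψ hεψ) hA
    (s.comp ψ.toContinuousMap) (section_comp_isLift q s hs ψ) (Λ := Λ) χ
  rw [h1, ← h2, ← h3]
  rfl

end ContinuousCohomology
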